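import Summits.BirchSwinnertonDyer.BirchSwinnertonDyer.Theorems.ByReductionTypeAtTwoSupersingularFlatBlindPinchBSDp
import Summits.BirchSwinnertonDyer.Rank1Residual.Supersingular.BlindInterpolationFlatTwoUnit
import Summits.BirchSwinnertonDyer.Rank1Residual.Supersingular.FrobeniusTraceTwoParity
import Summits.BirchSwinnertonDyer.Rank1Residual.P2.EmptyCellsAtTwo
import Literature.NumberTheory.EllipticCurves.LeadingTermPPartProofs
import HarnessLib

/-!
# W-88 — the twist-point pinch at `2` FROM THE INTEGRAL AVATAR `G` of `ϖ·L♭` (cell `bsd-f1-sign2`, seat `-imc` g36; helper for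
crux `SupersingularRankZeroAtTwo`, item stmt-BirchSwinnertonDyer-19097, registered line `odd_blind_package` v2.17 «K87 pinch wiring»)

WHAT.  `FlatBlindPinch.bsdp_two_of_flatBlindPinch` (★★ p829313, D-imc-87 §3) closes `BSDp W 2` from a SIGNED DATUM `D = (ξ, L′, c)`
(`2 ∤ c`, (K), (P), `ξ ∣ L′`, `μ(L′) = 0`, `λ(L′) ≤ 1`) and the blind zero `(T + 2) ∣ ξ`.  On the ♭ line at `2` the datum is not primitive:
what the Kato half of the line produces (`SSFlatRoad.flatUpper_two_of_flatColemanKato_of_fineMu`) is a characteristic element `ξ` of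
`X♭` together with the INTEGRAL AVATAR `G ∈ Λ = ℤ₂⟦T⟧` of `ϖ·L♭` — `ι G = C(ϖ)·ι L♭`, `ξ ∣ G` — for the newform `f` of `E = W`, its
period ratio `ϖ` (`ϖ·Ω_E = Ω⁺_f`) and a Sprung pair `(L♯, L♭)` at `2`.  This file does the SIGN BOOKKEEPING once, in kernel:
`G(0) = c♭·ϖ·[0]⁺_f` with `c♭ = −a₂² + 2a₂ + 1 ∈ {1, −7}` (`constantCoeff_flat_two_of_isSprungPair_of_isNewformOf`, `a₂ ∈ {0, ±2}` at a
good supersingular `2`), so `D := (ξ, G, 1)` resp. `(ξ, −G, 7)` satisfies (P) with `t = ϖ·[0]⁺_f = L(E,1)/Ω_E`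
(`IsNewformOf.entireLFunction_one_eq`) and an ODD constant; `μ`, `λ` are insensitive to the sign (`mu_mul` / `lam_mul` with the unit `−1`).
Hence the pinch closes `BSDp W 2` from: GZK (`rank_eq_analyticRank_of_analyticRank_le_one`), `GoodSS W 2`, `L(E,1) ≠ 0`, the binders
`f, ϖ, (L♯, L♭), ξ, G` with `ι G = C(ϖ)·ι L♭`, `ξ ∣ G`, (K) for `ξ`, the TABLE BITS `μ(G) = 0 ∧ λ(G) ≤ 1`, and the blind zero
`(T + 2) ∣ ξ` (K87-C ★★ p827897 `BlindPinch.blindZeroOfTwistSelmerCorankAtTwo` from `corank Sel_{2^∞}(E^{(2)}/ℚ) ≥ 2`).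
The registered line's v2.17 pinch branch is then ONE call of `bsdp_two_of_flatBlindPinch_of_avatar` fed by stubs 1–3 and a per-curve
TWIST-PINCH CERTIFICATE (`∃ W₂ ≅ E^{(2)}, corank ≥ 2` ∧ `μ(G) = 0 ∧ λ(G) ≤ 1` for every avatar `G`) — no value law, no lower-bound stub.

HONESTY.  A bookkeeping helper (theorems only: no definition, no named fact, no instance, no `sorry`; axioms the standard trio).  It closes no
registered stub; 19097 OPEN on 5 of 6 registered stubs (v2.16); BSD proved for no curve.  [cite: Sprung2017, Thm. 1.12, Cor. 4.4 (constant term)]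
[cite: Kobayashi2003, Thm. 1.2 (shape of the signed datum)]
-/

open scoped Classical MatrixGroups ModularForm NumberField
open NumberField IsDedekindDomain CongruenceSubgroup WeierstrassCurve PowerSeries
open Literature.NumberTheory.EllipticCurves Literature.NumberTheory.EllipticCurves.IwasawaDual
  Literature.NumberTheory.EllipticCurves.Sprung2012 Literature.NumberTheory.EllipticCurves.Sprung2017
  Literature.NumberTheory.EllipticCurves.ModularForms
  Literature.NumberTheory.EllipticCurves.Rank1Residual Literature.NumberTheory.EllipticCurves.Rank1Residual.Typed
  Literature.NumberTheory.EllipticCurves.Kobayashi2003 Literature.NumberTheory.GaloisRepresentations ZpExtension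
  Literature.NumberTheory.EllipticCurves.AcSigned
open Summit.BirchSwinnertonDyer.Rank1Residual Summit.BirchSwinnertonDyer.Rank1Residual.Supersingular
  Summit.BirchSwinnertonDyer.Rank1Residual.X5.O1 Summit.BirchSwinnertonDyer.Rank1Residual.X1.MuLambda
  Summit.BirchSwinnertonDyer.BirchSwinnertonDyer.Theorems

set_option linter.dupNamespace false
set_option autoImplicit false

namespace Summit.BirchSwinnertonDyer.BirchSwinnertonDyer.Theorems.FlatBlindPinch

/-- `μ` and `λ` are insensitive to the sign: `μ(−G) = μ(G)`, `λ(−G) = λ(G)` for `G ≠ 0` (`−1` is a unit of `Λ`). [folklore] -/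
theorem mu_neg_eq_and_lam_neg_eq {G : IwasawaAlgebra 2} (hG : G ≠ 0) : mu (-G) = mu G ∧ lam (-G) = lam G := by
  obtain ⟨hne1, hmu1, hlam1⟩ := (isUnit_iff_mu_eq_zero_and_lam_eq_zero (-1 : IwasawaAlgebra 2)).mp isUnit_one.neg
  have hneg : -G = (-1) * G := by ring
  refine ⟨?_, ?_⟩
  · rw [hneg, mu_mul hne1 hG, hmu1, zero_add]
  · rw [hneg, lam_mul hne1 hG, hlam1, zero_add]

/-- **W-88 — THE TWIST-POINT PINCH AT `2` FROM THE INTEGRAL AVATAR `G` OF `ϖ·L♭`.**  From GZK, `GoodSS W 2`, `L(E,1) ≠ 0`, the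
newform `f` of `E = W`, its period ratio `ϖ` (`ϖ·Ω_E = Ω⁺_f`), a Sprung pair `(L♯, L♭)` at `2`, an avatar `G ∈ Λ` with `ι G = C(ϖ)·ι L♭`,
a characteristic element `ξ` with `ξ ∣ G` and (K), the table bits `μ(G) = 0 ∧ λ(G) ≤ 1`, and the blind zero `(T + 2) ∣ ξ`: `BSDp W 2`.
Sign bookkeeping (`G(0) = c♭·ϖ·[0]⁺_f`, `c♭ ∈ {1, −7}`) turns `(ξ, ±G, 1 | 7)` into a `SignedDatum` with (P) and an odd constant, and
`bsdp_two_of_flatBlindPinch` (★★ p829313) concludes. [cite: Sprung2017, Thm. 1.12, Cor. 4.4] [cite: Kobayashi2003, Thm. 1.2 (shape)] -/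
theorem bsdp_two_of_flatBlindPinch_of_avatar (W : WeierstrassCurve ℚ) [W.IsElliptic] [W.IsGloballyMinimal]
    (hGZK : rank_eq_analyticRank_of_analyticRank_le_one) (hss : GoodSS W 2) (hL1 : W.entireLFunction 1 ≠ 0)
    [NeZero (W.conductorNorm ℤ)] {f : CuspForm (Gamma0 (W.conductorNorm ℤ)) 2} (hf : IsNewformOf W f)
    {ϖ : ℚ} (hϖ : (ϖ : ℝ) * W.realPeriodRat = plusPeriod f)
    {Ls Lf : IwasawaAlgebra 2} (hSP : IsSprungPair f 2 (W.frobeniusTrace 2) Ls Lf)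
    {ξ G : IwasawaAlgebra 2}
    (hG : iwasawaToPowerSeries 2 G = PowerSeries.C (ϖ : ℚ_[2]) * iwasawaToPowerSeries 2 Lf) (hξG : ξ ∣ G)
    (hK : Finite (W.selmerGroupPInfty 2) →
      ∃ u : ℤ_[2]ˣ, ((PowerSeries.constantCoeff ξ : ℤ_[2]) : ℚ_[2]) =
        ((u : ℤ_[2]) : ℚ_[2]) * ((2 : ℕ) : ℚ_[2]) ^ (padicValNat 2 W.tamagawaProduct) *
          (Nat.card (W.selmerGroupPInfty 2) : ℚ_[2]))
    (hμ : mu G = 0) (hlam : lam G ≤ 1)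
    (hZ : (PowerSeries.X + PowerSeries.C (2 : ℤ_[2]) : IwasawaAlgebra 2) ∣ ξ) : BSDp W 2 := by
  have hirr : W.HasIrreducibleModPGaloisRep 2 := P2.irr_two_of_goodSS_two W hss
  have hΩpos : 0 < W.realPeriodRat := W.realPeriodRat_pos_holds
  -- (P) at the trivial character: `t = L(E,1)/Ω_E = ϖ·[0]⁺_f`
  set s₀ : ℚ := ratPlusSymbol f 0 with hs_def
  set t : ℚ := ϖ * s₀ with ht_def
  have ht : W.entireLFunction 1 / (W.realPeriodRat : ℂ) = ((t : ℚ) : ℂ) := by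
    rw [hf.entireLFunction_one_eq, ← hϖ, div_eq_iff (Complex.ofReal_ne_zero.mpr hΩpos.ne'), ht_def]
    push_cast
    ring
  have ht0 : t ≠ 0 := by
    intro h0
    apply hL1
    have h1 := ht
    rw [h0, div_eq_iff (Complex.ofReal_ne_zero.mpr hΩpos.ne')] at h1
    simpa using h1
  -- the constant term of the avatar: `G(0) = c♭·t`, `c♭ = −a₂² + 2a₂ + 1 ∈ {1, −7}`
  set cf : ℚ := -(W.frobeniusTrace 2 : ℚ) ^ 2 + 2 * (W.frobeniusTrace 2) + 1 with hcf_def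
  have hLf0 := constantCoeff_flat_two_of_isSprungPair_of_isNewformOf hf hss.1 hSP
  have hϖLf : (ϖ : ℚ_[2]) * ((PowerSeries.constantCoeff Lf : ℤ_[2]) : ℚ_[2]) = (((cf * t : ℚ)) : ℚ_[2]) := by
    rw [hLf0, ht_def, hcf_def]
    push_cast
    ring
  have hG0 : ((PowerSeries.constantCoeff G : ℤ_[2]) : ℚ_[2]) = (((cf * t : ℚ)) : ℚ_[2]) := by
    have hc0 := congrArg PowerSeries.constantCoeff hG
    rw [map_mul PowerSeries.constantCoeff (PowerSeries.C (ϖ : ℚ_[2])), PowerSeries.constantCoeff_C,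
      constantCoeff_iwasawaToPowerSeries, constantCoeff_iwasawaToPowerSeries, hϖLf] at hc0
    exact hc0
  have hcf1 : cf = 1 ∨ cf = -7 := by
    rcases frobeniusTrace_two_eq_zero_or W hss.1 hss.2 with h0 | h0 | h0
    · left; rw [hcf_def, h0]; norm_num
    · left; rw [hcf_def, h0]; norm_num
    · right; rw [hcf_def, h0]; norm_num
  have hGne : G ≠ 0 := by
    intro h0
    have h1 : (((cf * t : ℚ)) : ℚ_[2]) = 0 := by rw [← hG0, h0, map_zero, PadicInt.coe_zero]
    have h2 : cf * t = 0 := by exact_mod_cast h1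
    rcases mul_eq_zero.mp h2 with h3 | h3
    · rcases hcf1 with h4 | h4 <;> rw [h4] at h3 <;> norm_num at h3
    · exact ht0 h3
  rcases hcf1 with h1 | h1
  · -- `c♭ = 1`: the datum `(ξ, G, 1)`
    have hP : (⟨ξ, G, 1⟩ : SignedDatum W 2).Interpolation := by
      refine ⟨t, ht, ?_⟩
      show ((PowerSeries.constantCoeff G : ℤ_[2]) : ℚ_[2]) = ((1 : ℕ) : ℚ_[2]) * ((t : ℚ) : ℚ_[2])
      rw [hG0, h1]
      push_cast
      ring
    exact bsdp_two_of_flatBlindPinch W hGZK hirr hL1 ⟨ξ, G, 1⟩ (by norm_num) hK hP hξG hμ hlam hZ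
  · -- `c♭ = −7`: the datum `(ξ, −G, 7)`
    have hP : (⟨ξ, -G, 7⟩ : SignedDatum W 2).Interpolation := by
      refine ⟨t, ht, ?_⟩
      show ((PowerSeries.constantCoeff (-G) : ℤ_[2]) : ℚ_[2]) = ((7 : ℕ) : ℚ_[2]) * ((t : ℚ) : ℚ_[2])
      rw [map_neg, PadicInt.coe_neg, hG0, h1]
      push_cast
      ring
    obtain ⟨hμ', hlam'⟩ := mu_neg_eq_and_lam_neg_eq hGne
    exact bsdp_two_of_flatBlindPinch W hGZK hirr hL1 ⟨ξ, -G, 7⟩ (by norm_num) hK hP hξG.neg_right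
      (hμ'.trans hμ) (hlam'.le.trans hlam) hZ

end Summit.BirchSwinnertonDyer.BirchSwinnertonDyer.Theorems.FlatBlindPinch
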